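import Summits.QuantumFields.YangMills.Theorems.BalabanUVNodesN11TkFibreReading

/-!
# DAG node N11 — 11a's `𝐓` READS ITS OPERAND ONLY ON THE ITERATED AVERAGING FIBRE: the multi-generation a.e. reading support (induction over generations, the
# bad null sets transported through the disintegration) — core: generic lemmas and the descending-invariant congruence

HEADER — WORK-UNIT METADATA.  Cell `pub-ymgap`, YM-PLAN Track A (HUMAN RULING D-0062), seat `pub-ymgap-dag-n11-d` (g13; R134 fan-out seat N11 [B14], strategy s2),
route `BalabanUVNodes`, item K1⁷ `StabilityBAtRecordR13SepCoPH` = stmt-QuantumFields-20542 (helper, `--kind proof --supports 20542 --as helper`, count-neutral).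
[III] = [Balaban1988Convergent], [B7] = [Balaban1985Averaging].  Over this seat's `…N11TkFibreReading` (p599037: ONE generation reads its operand on the fibre, a.e.),
p589098 `…N11TkReadingSupport` (pointwise reading support, descending invariants), 11a `Node00/TkOfRecord` (`genOp`, `genDataOfRecord`, `tkBranchOfRecord`,
`avgRestrOfRecord`), `T4AveragingDisintegration` (`condLaw`, `jointLaw`, `kernelTransport`), g6 `Node00/TkFirstStepRegionVanishing` (`measurable_avgRestrOfRecord`).

WHY THIS FILE (HANDOFF §g12 «NEXT DOOR»; `…N11Data7TopZeroOfRead`).  The no-expansion 𝐓-step's background ∕ junction rows (`…SpaceTruncationCharged(Sep)`,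
`…ChargedSepJunctionOfSolvable`) are demanded at EVERY configuration of p589098's reading support, and the (7)-data row there reads the MIXED field
`mixedField … (𝐖 (m+1)) (𝐖 m)` — `avg(𝐖 m)` on the bonds off `Λ_{m+1}` — which per-level regularities control only together with the FIBRE IDENTITY `avg(𝐖 m) = 𝐖 (m+1)`.
That identity holds on the support of 11a's kernel transports, but only ALMOST EVERYWHERE in the coarse variables, generation by generation; since `HasSect2FormAtZS`'s identity
clause is itself an a.e. statement in `V_k`, an a.e.-in-`V_k` reading support ON THE ITERATED FIBRE is exactly what the chain can consume.  This file proves its core.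

WHAT THIS FILE PROVES (0 `sorry`, 0 `def`).
* §1 `condLaw_null_ae` (a `ν`-null set of fine configurations is `condLaw(y)`-null for `(avg_*ν)`-a.e. `y`; disintegration + `Measure.ae_ae_of_ae_compProd`, no measurability of
  the null set); ★ `kernelTransport_ae_congr_of_fibre_off_null` — p599037's AC-free fibre reading WITH an excluded null set of fine configurations.
* §2 `kernelRT_ae_congr_of_fibre_off_null`; `measurePreserving_restrict₂_pi` (restriction of product Haar to a sub-bond-set, from Mathlib's `isProjectiveMeasureFamily_pi`);
  `genOp_congr_supp_fibre_off_of_good` (one generation with an admissibility predicate on the integrated bond variables); `updateFinset` bookkeeping.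
* §3 `genOp_genDataOfRecord_congr_supp_fibre_off_null_ae` (one generation of record off a null set, a.e. in the RESTRICTED coarse variables); `Ω_succ_succ_subset`,
  `sV'_subset_sV_succ` (the image bond set of generation `i` lies in the V-bond set of generation `i+1`, (2.1)); `baseCfg_fst_of_ne`; `avg_updateFinset_eq_of_trivial_off`
  (the fibre identity in `avOfRecord` form when the old scale-`j` field is `1` off the V-bonds).
* §4 ★★ `tkBranchOfRecord_congr_of_descending_fibre_ae` — THE MULTI-GENERATION a.e. READING SUPPORT: p589098's descending-invariant congruence of `𝐓_{i+1}(s, S)` with the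
  step hypothesis WEAKENED to charged scale-`i` updates that AGREE with the old scale-`i` field off `bondsIn i (Ω_{i+1})ᶜ` and — granted the old field is `1` there — satisfy
  `(avOfRecord i).avg (new field) b = (ω (i+1)).1 b` on `bondsIn (i+1) (Ω_{i+1})ᶜ`; valid for product-Haar-a.e. restriction of the scale-`(i+1)` field to `bondsIn (i+1) (Ω_{i+1})ᶜ`,
  uniformly in the branch `S`, the invariant, and the operands.  Induction over `i`: generation `i+1` integrates `y` on `bondsIn (i+1) (Ω_{i+2})ᶜ ⊇ bondsIn (i+1) (Ω_{i+1})ᶜ`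
  over the fibre OFF the null set where the level-`i` statement fails at `y|` (§2's restriction pushes product Haar forward; §1 makes the conditional laws blind to it).
The value-level faces (`TkOfRecord` ∕ `sect2Slot`, `fieldMeasure`-a.e. in `V_n`; the `RegOn` editions) are the sequel `…N11TkIteratedFibreReadingSlot`.

HONEST FRAMING.  Helper lane of K1⁷; generic measure theory and kernel bookkeeping of (2.20)–(2.21) over 11a's objects; nothing of Bałaban's is asserted.  N11 NOT discharged;
K1⁷ NOT closed; counts unmoved (typed 28∕28 · discharged 5∕27).  One finite four-torus programme at fixed `ε = L^{−K}` — NOT ℝ⁴, NOT OS, NOT a mass gap, NOT Clay.  No `sorry`,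
`axiom`, `def`, `instance`, `notation`.  Sources (SHAPE only): [III] (2.1) p.254, (2.18) p.257, (2.20)–(2.21) p.258, (3.24) p.270, (1.4) p.246; [B7] (9)–(10) p.19.
-/

noncomputable section

open MeasureTheory
open scoped BigOperators ENNReal NNReal Matrix.Norms.L2Operator

universe u

namespace Summit.QuantumFields.YangMills.Theorems.BalabanUVNodesN11TkIteratedFibreReading

open Literature.MathematicalPhysics.QuantumFieldTheory.Balaban1983to89 T4Continuum Node00 Node00.Tk
open T4AveragingDisintegration (kernelTransport condLaw margDensity jointLaw condLaw_fibre_ae jointLaw_fst jointLaw_snd fst_compProd_condLaw)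
open T4AdjointCovariance (JCfg insA)
open B15DeterminingSets B10Eq42TorusConstraint B8Eq17ClassAkV1
open BalabanUVNodesN11TkReadingSupport (baseCfg_top_fst)

/-! ## §1  Generic: a.e. in the coarse point, the kernel transport reads the integrand only on the fibre OFF any null set of fine configurations -/

section Generic

variable {α β : Type*} [MeasurableSpace α] [MeasurableSpace β] [StandardBorelSpace β] [Nonempty β]

/-- **A `ν`-NULL SET OF FINE CONFIGURATIONS IS `condLaw(y)`-NULL FOR `(avg_*ν)`-a.e. COARSE `y`** (disintegration `(avg_*ν) ⊗ condLaw = law of (avg U, U)`;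
no measurability of the null set is needed — a measurable null hull is disintegrated). [cite: Balaban1985Averaging, (10) p.19 (bookkeeping)] -/
theorem condLaw_null_ae (ν : Measure β) [IsFiniteMeasure ν] {avg : β → α} (havg : Measurable avg) {B : Set β} (hB : ν B = 0) :
    ∀ᵐ y ∂(ν.map avg), ∀ᵐ U ∂(condLaw ν avg y), U ∉ B := by
  obtain ⟨Ns, hBN, hNm, hN0⟩ := exists_measurable_superset_of_null hB
  have h1 : ∀ᵐ z ∂(jointLaw ν avg), z.2 ∉ Ns := by
    have h0 : (jointLaw ν avg) (Prod.snd ⁻¹' Ns) = 0 := by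
      rw [← Measure.snd_apply hNm, jointLaw_snd ν havg]; exact hN0
    exact measure_eq_zero_iff_ae_notMem.1 h0
  rw [← fst_compProd_condLaw ν avg] at h1
  have h2 := Measure.ae_ae_of_ae_compProd h1
  rw [jointLaw_fst ν havg] at h2
  filter_upwards [h2] with y hy
  exact hy.mono fun U hU hUB => hU (hBN hUB)

/-- **★ AC-FREE FIBRE READING OFF A NULL SET**: for any `ν`-null set `B` of fine configurations, for `μ`-almost every coarse point `y`, ANY two integrands that
agree on the fibre `{U | avg U = y}` OUTSIDE `B` have the same kernel transport at `y`.  Where the marginal density `d(avg_*ν)∕dμ` vanishes both transports are `0`;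
on its support the conditional law gives full mass to the fibre and zero mass to `B` (`condLaw_fibre_ae`, `condLaw_null_ae`, both `(avg_*ν)`-a.e., transferred through
`μ.withDensity (d(avg_*ν)∕dμ) ≤ avg_*ν`).  No absolute continuity, no integrability. [cite: Balaban1985Averaging, (10) p.19 (bookkeeping); Balaban1988Convergent, (2.21) p.258] -/
theorem kernelTransport_ae_congr_of_fibre_off_null (ν : Measure β) [IsFiniteMeasure ν] (μ : Measure α) [SigmaFinite μ] {avg : β → α}
    (havg : Measurable avg) [MeasurableEq α] {B : Set β} (hB : ν B = 0) :
    ∀ᵐ y ∂μ, ∀ f g : β → ℝ, (∀ U, avg U = y → U ∉ B → f U = g U) → kernelTransport ν μ avg f y = kernelTransport ν μ avg g y := by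
  have hfib := condLaw_fibre_ae ν havg
  have hnull := condLaw_null_ae ν havg hB
  have hle : μ.withDensity ((ν.map avg).rnDeriv μ) ≤ ν.map avg := Measure.withDensity_rnDeriv_le _ _
  have h1 : ∀ᵐ y ∂μ.withDensity ((ν.map avg).rnDeriv μ), condLaw ν avg y {U | avg U = y} = 1 ∧ ∀ᵐ U ∂(condLaw ν avg y), U ∉ B :=
    (Measure.absolutelyContinuous_of_le hle).ae_le (hfib.and hnull)
  rw [ae_withDensity_iff (Measure.measurable_rnDeriv _ _)] at h1
  filter_upwards [h1] with y hy f g hfg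
  unfold kernelTransport
  by_cases h0 : margDensity ν μ avg y = 0
  · rw [h0, NNReal.coe_zero, zero_mul, zero_mul]
  · have hr : (ν.map avg).rnDeriv μ y ≠ 0 := by
      intro h
      apply h0
      show ((jointLaw ν avg).fst.rnDeriv μ y).toNNReal = 0
      rw [jointLaw_fst ν havg, h, ENNReal.toNNReal_zero]
    obtain ⟨hfull, hB'⟩ := hy hr
    have hS : MeasurableSet {U : β | avg U = y} := measurableSet_eq_fun havg measurable_const
    have hc : condLaw ν avg y {U : β | avg U = y}ᶜ = 0 := (prob_compl_eq_zero_iff hS).2 hfull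
    have hmem : ∀ᵐ U ∂(condLaw ν avg y), U ∈ {U : β | avg U = y} := mem_ae_iff.2 hc
    have hae : ∀ᵐ U ∂(condLaw ν avg y), f U = g U := by
      filter_upwards [hmem, hB'] with U hU hUB using hfg U hU hUB
    rw [integral_congr_ae hae]

end Generic

/-! ## §2  11a's restricted kernel transport, sub-bond-set restriction, and one generation off a null set -/

section OneGen

variable {G : Type u} [GaugeGroup G] [MeasurableSpace G] [HaarData G] [StandardBorelSpace G]

/-- **THE a.e. FIBRE READING OF 11a's RESTRICTED KERNEL TRANSPORT OFF A NULL SET**: for a product-Haar-null set `B` of fine bond configurations and product-Haar-a.e. coarse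
configuration `y′`, integrands agreeing on `avg⁻¹{y′} ∖ B` have the same `kernelRT avg`-image at `y′`. [cite: Balaban1988Convergent, (2.21) p.258 (bookkeeping)] -/
theorem kernelRT_ae_congr_of_fibre_off_null {ι ι' : Type*} [Fintype ι] [Fintype ι'] [MeasurableEq (ι' → G)] {avg : (ι → G) → (ι' → G)}
    (havg : Measurable avg) {B : Set (ι → G)} (hB : Measure.pi (fun _ : ι => (HaarData.haar : Measure G)) B = 0) :
    ∀ᵐ y' ∂(Measure.pi fun _ : ι' => (HaarData.haar : Measure G)),
      ∀ f g : (ι → G) → ℝ, (∀ y, avg y = y' → y ∉ B → f y = g y) → kernelRT avg f y' = kernelRT avg g y' :=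
  kernelTransport_ae_congr_of_fibre_off_null _ _ havg hB

omit [StandardBorelSpace G] in
/-- **RESTRICTING PRODUCT HAAR ON A BOND SET TO A SUB-BOND-SET IS MEASURE PRESERVING** (the other coordinates integrate to `1`; Mathlib's projectivity of finite
products of probability measures). [cite: Balaban1985Averaging, (10) p.19 (bookkeeping)] -/
theorem measurePreserving_restrict₂_pi {ι : Type*} {A B : Finset ι} (h : A ⊆ B) :
    MeasurePreserving (Finset.restrict₂ (π := fun _ => G) h) (Measure.pi fun _ : ↥B => (HaarData.haar : Measure G))
      (Measure.pi fun _ : ↥A => (HaarData.haar : Measure G)) :=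
  ⟨Finset.measurable_restrict₂ _, (isProjectiveMeasureFamily_pi (fun _ : ι => (HaarData.haar : Measure G)) B A h).symm⟩

variable {P : Params} {V : Type u} [NormedAddCommGroup V] [InnerProductSpace ℝ V] [FiniteDimensional ℝ V] [MeasurableSpace V] [BorelSpace V]

/-- **ONE GENERATION `𝐓^{(j)}` WITH THE KERNEL TRANSPORT READS ITS OPERAND ONLY WHERE `ζ_j ≠ 0`, `w_j ≠ 0`, ON THE AVERAGING FIBRE, AND AT ADMISSIBLE FINE VARIABLES**
— FILE 8's `genOp_congr_supp_fibre_of_good` with an arbitrary admissibility predicate `Adm` on the integrated bond variables `y` (of record: the complement of a null set)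
added to the good-point property and to the agreement hypothesis. [cite: Balaban1988Convergent, (2.20)–(2.21) p.258] -/
theorem genOp_congr_supp_fibre_off_of_good {j : ℕ} {hdec : DecidableEq (PBond P j)} (D : GenData P G V j) {avg : (↥D.sV → G) → (↥D.sV' → G)}
    (hT : D.vT = kernelRT avg) (Adm : (↥D.sV → G) → Prop) {F F' : MultiCfg P G V → ℝ} (ω : MultiCfg P G V)
    (hgood : ∀ f g : (↥D.sV → G) → ℝ, (∀ y, avg y = (fun b : ↥D.sV' => (ω (j + 1)).1 (b : PBond P (j + 1))) → Adm y → f y = g y) →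
      kernelRT avg f (fun b : ↥D.sV' => (ω (j + 1)).1 (b : PBond P (j + 1))) = kernelRT avg g (fun b : ↥D.sV' => (ω (j + 1)).1 (b : PBond P (j + 1))))
    (h : ∀ (y : ↥D.sV → G) (a : ↥D.sA → V), avg y = (fun b : ↥D.sV' => (ω (j + 1)).1 (b : PBond P (j + 1))) → Adm y →
      D.ζ (Function.update ω j (Function.updateFinset (ω j).1 D.sV y, (ω j).2)) ≠ 0 →
      D.w (Function.update (Function.update ω j (Function.updateFinset (ω j).1 D.sV y, (ω j).2)) j
          (insA D.sA a ((Function.update ω j (Function.updateFinset (ω j).1 D.sV y, (ω j).2)) j))) ≠ 0 →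
      F (Function.update (Function.update ω j (Function.updateFinset (ω j).1 D.sV y, (ω j).2)) j
          (insA D.sA a ((Function.update ω j (Function.updateFinset (ω j).1 D.sV y, (ω j).2)) j))) =
      F' (Function.update (Function.update ω j (Function.updateFinset (ω j).1 D.sV y, (ω j).2)) j
          (insA D.sA a ((Function.update ω j (Function.updateFinset (ω j).1 D.sV y, (ω j).2)) j)))) :
    genOp j D F ω = genOp j D F' ω := by
  simp only [genOp_apply, vOp_apply, hT]
  refine hgood _ _ fun y hy hA => ?_
  simp only [zetaOp_apply]
  by_cases hζ : D.ζ (Function.update ω j (Function.updateFinset (ω j).1 D.sV y, (ω j).2)) = 0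
  · rw [hζ, zero_mul, zero_mul]
  · congr 1
    rw [aOp_apply, aOp_apply]
    refine integral_congr_ae (Filter.Eventually.of_forall fun a => ?_)
    by_cases hw : D.w (Function.update (Function.update ω j (Function.updateFinset (ω j).1 D.sV y, (ω j).2)) j
        (insA D.sA a ((Function.update ω j (Function.updateFinset (ω j).1 D.sV y, (ω j).2)) j))) = 0
    · show D.w _ * F _ = D.w _ * F' _
      rw [hw, zero_mul, zero_mul]
    · show D.w _ * F _ = D.w _ * F' _
      rw [h y a hy hA hζ hw]

end OneGen

/-! ### Two bookkeeping faces of `Function.updateFinset` (any decidability instance) -/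

section Upd

variable {ι : Type*} {E : Type*}

/-- Off the updated finset the updated function is the old one. [cite: Balaban1988Convergent, (2.21) p.258 (bookkeeping)] -/
theorem updateFinset_apply_of_notMem {hdec : DecidableEq ι} (f : ι → E) (s : Finset ι) (y : ↥s → E) {b : ι} (hb : b ∉ s) :
    Function.updateFinset f s y b = f b := by
  simp [Function.updateFinset_def, hb]

/-- On the updated finset the updated function is the inserted datum. [cite: Balaban1988Convergent, (2.21) p.258 (bookkeeping)] -/
theorem updateFinset_apply_of_mem {hdec : DecidableEq ι} (f : ι → E) (s : Finset ι) (y : ↥s → E) {b : ι} (hb : b ∈ s) :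
    Function.updateFinset f s y b = y ⟨b, hb⟩ := by
  simp [Function.updateFinset_def, hb]

/-- Updating two functions that agree off the finset gives the same function. [cite: Balaban1988Convergent, (2.21) p.258 (bookkeeping)] -/
theorem updateFinset_congr_of_eqOn_compl {hdec : DecidableEq ι} (f f' : ι → E) (s : Finset ι) (y : ↥s → E) (h : ∀ b, b ∉ s → f b = f' b) :
    Function.updateFinset f s y = Function.updateFinset f' s y := by
  funext b
  by_cases hb : b ∈ s
  · rw [updateFinset_apply_of_mem f s y hb, updateFinset_apply_of_mem f' s y hb]
  · rw [updateFinset_apply_of_notMem f s y hb, updateFinset_apply_of_notMem f' s y hb, h b hb]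

end Upd

/-! ## §3  At 11a's generation data of record: one generation off a null set, a.e. in the restricted coarse variables -/

section Record

variable {F : T4Family} {N : ℕ} [NeZero N] {V : Type} [NormedAddCommGroup V] [InnerProductSpace ℝ V] [FiniteDimensional ℝ V] [MeasurableSpace V] [BorelSpace V]
variable (ν : Stage7Numerics) (M : ℕ) (g : ℕ → ℝ) (K : ℕ) (W : TkWeights F N V K)

/-- **ONE GENERATION OF RECORD READS ITS OPERAND ONLY ON THE FIBRE OFF A NULL SET, a.e. IN THE RESTRICTED COARSE VARIABLES**: for a product-Haar-null set `B` of
scale-`j` bond configurations on `bondsIn j (Ω_{j+1})ᶜ` and product-Haar-a.e. `c` on `bondsIn (j+1) (Ω_{j+1})ᶜ`, at EVERY branch `S` and every all-scales configuration `ω`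
whose scale-`(j+1)` field restricts to `c`, two operands agreeing at the charged updates `ω_{y,a}` (`ζ ≠ 0`, `w ≠ 0`) with `avgRestrOfRecord y = c` and `y ∉ B` have the
same image under generation `j` of record. [cite: Balaban1988Convergent, (2.20)–(2.21) p.258, (3.24) p.270] -/
theorem genOp_genDataOfRecord_congr_supp_fibre_off_null_ae {k : ℕ} (s : SeqOfRecord F ν M g K k) (j : ℕ) {hdec : DecidableEq (PBond (F.P K) j)}
    {B : Set (↥(Set.toFinite (bondsIn j (s.Ω (j + 1))ᶜ)).toFinset → SU N)}
    (hB : Measure.pi (fun _ : ↥(Set.toFinite (bondsIn j (s.Ω (j + 1))ᶜ)).toFinset => (HaarData.haar : Measure (SU N))) B = 0) :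
    ∀ᵐ c ∂(Measure.pi fun _ : ↥(Set.toFinite (bondsIn (j + 1) (s.Ω (j + 1))ᶜ)).toFinset => (HaarData.haar : Measure (SU N))),
      ∀ (S : ℕ → Set (Site (F.P K) 0)) (ω : MultiCfg (F.P K) (SU N) V),
      (fun b : ↥(Set.toFinite (bondsIn (j + 1) (s.Ω (j + 1))ᶜ)).toFinset => (ω (j + 1)).1 (b : PBond (F.P K) (j + 1))) = c →
      ∀ {Φ Φ' : MultiCfg (F.P K) (SU N) V → ℝ},
      (∀ (y : ↥(Set.toFinite (bondsIn j (s.Ω (j + 1))ᶜ)).toFinset → SU N) (a : ↥(genDataOfRecord F N V ν M g K W s S j).sA → V),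
        avgRestrOfRecord F N K j _ (Set.toFinite (bondsIn (j + 1) (s.Ω (j + 1))ᶜ)).toFinset y = c → y ∉ B →
        (genDataOfRecord F N V ν M g K W s S j).ζ
            (Function.update ω j (Function.updateFinset (ω j).1 (genDataOfRecord F N V ν M g K W s S j).sV y, (ω j).2)) ≠ 0 →
        (genDataOfRecord F N V ν M g K W s S j).w
            (Function.update (Function.update ω j (Function.updateFinset (ω j).1 (genDataOfRecord F N V ν M g K W s S j).sV y, (ω j).2)) j
              (insA (genDataOfRecord F N V ν M g K W s S j).sA a
                ((Function.update ω j (Function.updateFinset (ω j).1 (genDataOfRecord F N V ν M g K W s S j).sV y, (ω j).2)) j))) ≠ 0 →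
        Φ (Function.update (Function.update ω j (Function.updateFinset (ω j).1 (genDataOfRecord F N V ν M g K W s S j).sV y, (ω j).2)) j
            (insA (genDataOfRecord F N V ν M g K W s S j).sA a
              ((Function.update ω j (Function.updateFinset (ω j).1 (genDataOfRecord F N V ν M g K W s S j).sV y, (ω j).2)) j))) =
        Φ' (Function.update (Function.update ω j (Function.updateFinset (ω j).1 (genDataOfRecord F N V ν M g K W s S j).sV y, (ω j).2)) j
            (insA (genDataOfRecord F N V ν M g K W s S j).sA a
              ((Function.update ω j (Function.updateFinset (ω j).1 (genDataOfRecord F N V ν M g K W s S j).sV y, (ω j).2)) j)))) →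
      genOp j (genDataOfRecord F N V ν M g K W s S j) Φ ω = genOp j (genDataOfRecord F N V ν M g K W s S j) Φ' ω := by
  haveI : MeasurableEq (↥((Set.toFinite (bondsIn (j + 1) (s.Ω (j + 1))ᶜ)).toFinset) → SU N) := inferInstance
  have hgood := kernelRT_ae_congr_of_fibre_off_null (G := SU N)
    (measurable_avgRestrOfRecord (F := F) (N := N) K j (Set.toFinite (bondsIn j (s.Ω (j + 1))ᶜ)).toFinset
      (Set.toFinite (bondsIn (j + 1) (s.Ω (j + 1))ᶜ)).toFinset) hB
  filter_upwards [hgood] with c hc S ω hω Φ Φ' h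
  subst hω
  exact genOp_congr_supp_fibre_off_of_good (genDataOfRecord F N V ν M g K W s S j) rfl
    (fun y : (↥(Set.toFinite (bondsIn j (s.Ω (j + 1))ᶜ)).toFinset → SU N) => y ∉ B) ω hc h

omit [NeZero N] in
/-- Along a sequence of record the large-field regions decrease above level `1`: `Ω_{i+2} ⊆ Ω_{i+1}` ((2.1) on the window, `∅` beyond it).
[cite: Balaban1988Convergent, (2.1) p.254 (bookkeeping)] -/
theorem Ω_succ_succ_subset {n : ℕ} (s : SeqOfRecord F ν M g K n) (i : ℕ) : s.Ω (i + 2) ⊆ s.Ω (i + 1) := by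
  by_cases h : i + 2 ≤ n
  · exact s.chain.Ω_succ_subset_Ω (by omega) (by omega)
  · rw [s.Ω_off (i + 2) (by omega)]
    exact Set.empty_subset _

omit [NeZero N] in
/-- Hence the image bond set of generation `i` lies in the V-bond set of generation `i+1`: `bondsIn (i+1) (Ω_{i+1})ᶜ ⊆ bondsIn (i+1) (Ω_{i+2})ᶜ`.
[cite: Balaban1988Convergent, (2.1) p.254, (2.21) p.258 (bookkeeping)] -/
theorem sV'_subset_sV_succ {n : ℕ} (s : SeqOfRecord F ν M g K n) (i : ℕ) :
    (Set.toFinite (bondsIn (i + 1) (s.Ω (i + 1))ᶜ)).toFinset ⊆ (Set.toFinite (bondsIn (i + 1) (s.Ω (i + 1 + 1))ᶜ)).toFinset :=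
  Set.Finite.toFinset_subset_toFinset.2 (bondsIn_mono (Set.compl_subset_compl.2 (Ω_succ_succ_subset ν M g K s i)))

omit [NeZero N] [InnerProductSpace ℝ V] [FiniteDimensional ℝ V] [MeasurableSpace V] [BorelSpace V] in
/-- Below the top the base configuration has unit gauge variables. [cite: Balaban1988Convergent, (2.18) p.257 (bookkeeping)] -/
theorem baseCfg_fst_of_ne {n j : ℕ} (hj : j ≠ n) (Vn : GaugeField (F.P K) n (SU N)) (b : PBond (F.P K) j) :
    ((baseCfg (V := V) n Vn) j).1 b = 1 := by
  show (if h : j = n then Vn (h ▸ b) else 1) = 1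
  rw [dif_neg hj]

omit [InnerProductSpace ℝ V] [FiniteDimensional ℝ V] [MeasurableSpace V] [BorelSpace V] in
/-- **THE FIBRE IDENTITY IN `avOfRecord` FORM**: if the scale-`j` field `U` is `1` off the V-bond set `T₁`, the averaging of record of `U` updated by `y` on `T₁` IS the
restricted averaging of record of `y`; so `avgRestrOfRecord y = c` reads `(avOfRecord j).avg (U updated by y) = c` on `T₂`. [cite: Balaban1988Convergent, (2.21) p.258, (1.4) p.246 (bookkeeping)] -/
theorem avg_updateFinset_eq_of_trivial_off {j : ℕ} {hdec : DecidableEq (PBond (F.P K) j)} (T₁ : Finset (PBond (F.P K) j))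
    (T₂ : Finset (PBond (F.P K) (j + 1))) (U : GaugeField (F.P K) j (SU N)) (y : ↥T₁ → SU N) (c : ↥T₂ → SU N)
    (hy : avgRestrOfRecord F N K j T₁ T₂ y = c) (htriv : ∀ b, b ∉ T₁ → U b = 1) {b : PBond (F.P K) (j + 1)} (hb : b ∈ T₂) :
    (avOfRecord F N K j).avg (Function.updateFinset U T₁ y) b = c ⟨b, hb⟩ := by
  rw [updateFinset_congr_of_eqOn_compl U (fun _ => (1 : SU N)) T₁ y htriv]
  exact congrFun hy ⟨b, hb⟩

/-! ## §4  THE MULTI-GENERATION a.e. READING SUPPORT: congruence of `𝐓_{i+1}(s, S)` along a descending invariant that may use the fibre identity -/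

/-- **★★ CONGRUENCE OF `𝐓_{i+1}(s, S)` ALONG A DESCENDING INVARIANT THAT MAY USE THE FIBRE IDENTITY — a.e. IN THE RESTRICTED COARSE VARIABLES.**  Let `Good i` be
predicates on the all-scales configuration such that, whenever `Good (i+1) ω` holds and a scale-`i` update `ω[i ↦ c]` (with `c₀.1 = c.1`) is charged by the generation-`i`
weights (`ζ_i(Ω^c_{i+1})` at `ω[i ↦ c₀]`, `w_i` at `ω[i ↦ c]`), AGREES with the old scale-`i` field off `bondsIn i (Ω_{i+1})ᶜ`, and — granted the old scale-`i` field is `1`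
off that bond set — satisfies the FIBRE IDENTITY `(avOfRecord i).avg c.1 b = (ω (i+1)).1 b` on `bondsIn (i+1) (Ω_{i+1})ᶜ`, then `Good i (ω[i ↦ c])` holds.  Then for
product-Haar-a.e. `c` on `bondsIn (i+1) (Ω_{i+1})ᶜ`: for EVERY branch `S`, operands `Φ, Φ′` agreeing on `Good 0`, and configuration `ω` whose scale-`(i+1)` field restricts
to `c` with `Good (i+1) ω`, `𝐓_{i+1}(s,S)Φ ω = 𝐓_{i+1}(s,S)Φ′ ω`.  Induction over generations: generation `i+1` integrates `y` over the fibre off the null set where the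
level-`i` statement fails at `y|_{bondsIn (i+1) (Ω_{i+1})ᶜ}` (transported by `measurePreserving_restrict₂_pi` and the disintegration, §1–§3).
[cite: Balaban1988Convergent, (2.18) p.257, (2.20)–(2.21) p.258, (3.24) p.270; Balaban1985Averaging, (10) p.19] -/
theorem tkBranchOfRecord_congr_of_descending_fibre_ae {n : ℕ} (s : SeqOfRecord F ν M g K n) (i : ℕ) :
    ∀ᵐ c ∂(Measure.pi fun _ : ↥(Set.toFinite (bondsIn (i + 1) (s.Ω (i + 1))ᶜ)).toFinset => (HaarData.haar : Measure (SU N))),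
      ∀ (S : ℕ → Set (Site (F.P K) 0)) (Good : ℕ → MultiCfg (F.P K) (SU N) V → Prop),
      (∀ (i' : ℕ) (ω : MultiCfg (F.P K) (SU N) V) (c₀ c' : JCfg (F.P K) i' (SU N) V), Good (i' + 1) ω → c₀.1 = c'.1 →
        (∀ b : PBond (F.P K) i', b ∉ bondsIn i' (s.Ω (i' + 1))ᶜ → c'.1 b = (ω i').1 b) →
        ((∀ b : PBond (F.P K) i', b ∉ bondsIn i' (s.Ω (i' + 1))ᶜ → (ω i').1 b = 1) →
          ∀ b : PBond (F.P K) (i' + 1), b ∈ bondsIn (i' + 1) (s.Ω (i' + 1))ᶜ → (avOfRecord F N K i').avg c'.1 b = (ω (i' + 1)).1 b) →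
        W.ζ i' (s.Ω (i' + 1))ᶜ (Function.update ω i' c₀) ≠ 0 →
        W.w i' (s.Λ (i' + 1)) ((s.Λ (i' + 1))ᶜ ∩ s.Ω (i' + 1)) (S (i' + 1)) (Function.update ω i' c') ≠ 0 → Good i' (Function.update ω i' c')) →
      ∀ (Φ Φ' : MultiCfg (F.P K) (SU N) V → ℝ), (∀ ω, Good 0 ω → Φ ω = Φ' ω) →
      ∀ ω : MultiCfg (F.P K) (SU N) V,
        (fun b : ↥(Set.toFinite (bondsIn (i + 1) (s.Ω (i + 1))ᶜ)).toFinset => (ω (i + 1)).1 (b : PBond (F.P K) (i + 1))) = c → Good (i + 1) ω →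
        tkBranchOfRecord F N V ν M g K W s S (i + 1) Φ ω = tkBranchOfRecord F N V ν M g K W s S (i + 1) Φ' ω := by
  induction i with
  | zero =>
    have h1 := genOp_genDataOfRecord_congr_supp_fibre_off_null_ae ν M g K W s 0 (hdec := fun a b => Classical.propDecidable (a = b))
      (B := (∅ : Set (↥(Set.toFinite (bondsIn 0 (s.Ω (0 + 1))ᶜ)).toFinset → SU N))) (measure_empty)
    filter_upwards [h1] with c hc S Good hstep Φ Φ' h0 ω hω hG
    rw [tkBranchOfRecord_succ, tkBranchOfRecord_succ]
    refine hc S ω hω fun y a hy _ hζ hw => ?_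
    rw [Function.update_idem] at hw ⊢
    refine h0 _ (hstep 0 ω _ _ hG ?_ ?_ ?_ hζ hw)
    · simp only [Function.update_self, insA]
    · intro b hb
      simp only [Function.update_self, insA]
      exact updateFinset_apply_of_notMem (ω 0).1 _ y fun hb' => hb ((Set.Finite.mem_toFinset _).1 hb')
    · intro htriv b hb
      simp only [Function.update_self, insA]
      have hb' : b ∈ (Set.toFinite (bondsIn (0 + 1) (s.Ω (0 + 1))ᶜ)).toFinset := (Set.Finite.mem_toFinset _).2 hb
      exact (avg_updateFinset_eq_of_trivial_off K _ _ (ω 0).1 y c hy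
        (fun b'' hb'' => htriv b'' fun h' => hb'' ((Set.Finite.mem_toFinset _).2 h')) hb').trans (congrFun hω ⟨b, hb'⟩).symm
  | succ i ih =>
    have hsub := sV'_subset_sV_succ ν M g K s i
    have hpull := (measurePreserving_restrict₂_pi (G := SU N) hsub).quasiMeasurePreserving.ae ih
    have hB := ae_iff.1 hpull
    have h1 := genOp_genDataOfRecord_congr_supp_fibre_off_null_ae ν M g K W s (i + 1) (hdec := fun a b => Classical.propDecidable (a = b)) hB
    filter_upwards [h1] with c hc S Good hstep Φ Φ' h0 ω hω hG
    rw [tkBranchOfRecord_succ, tkBranchOfRecord_succ]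
    refine hc S ω hω fun y a hy hyB hζ hw => ?_
    rw [Function.update_idem] at hw ⊢
    have hQ := not_not.1 hyB
    refine hQ S Good hstep Φ Φ' h0 _ ?_ (hstep (i + 1) ω _ _ hG ?_ ?_ ?_ hζ hw)
    · funext b
      simp only [Function.update_self, insA]
      exact updateFinset_apply_of_mem (ω (i + 1)).1 _ y (hsub b.2)
    · simp only [Function.update_self, insA]
    · intro b hb
      simp only [Function.update_self, insA]
      exact updateFinset_apply_of_notMem (ω (i + 1)).1 _ y fun hb' => hb ((Set.Finite.mem_toFinset _).1 hb')
    · intro htriv b hb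
      simp only [Function.update_self, insA]
      have hb' : b ∈ (Set.toFinite (bondsIn (i + 1 + 1) (s.Ω (i + 1 + 1))ᶜ)).toFinset := (Set.Finite.mem_toFinset _).2 hb
      exact (avg_updateFinset_eq_of_trivial_off K _ _ (ω (i + 1)).1 y c hy
        (fun b'' hb'' => htriv b'' fun h' => hb'' ((Set.Finite.mem_toFinset _).2 h')) hb').trans (congrFun hω ⟨b, hb'⟩).symm

end Record

end Summit.QuantumFields.YangMills.Theorems.BalabanUVNodesN11TkIteratedFibreReading

end
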